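import Summits.ResolutionOfSingularities.ResolutionOfSingularities.Theses.TropicalLinks
import Literature.AlgebraicGeometry.Tropical.SchonIdeal

/-!
# Crux `InductiveStep` (stmt-ResolutionOfSingularities-17233) — negative knowledge: the exact shape of a
# counterexample, and the crux restated through the tree's `IsSchonIdeal`

Route `ResolutionOfSingularities/TropicalLinks`, crux `InductiveStep :=
∀ p prime, ∀ d, (∀ d' < d, SchonAt p d') → SchonAt p d` (cdisprove seat, cycle 1).  Kernel-checked facts
bounding every disproof attempt:

* `not_inductiveStep_iff_not_schonPlus` — the induction hypothesis is logically inert: a refutation of the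
  crux is EXACTLY a refutation of the rank-0 target `SchonPlus` (Tevelev's schön-open conjecture in
  characteristic `p`, Amer. J. Math. 129 (2007), Rem. 3.3, principal-open Gröbner form) — an open problem,
  `ledger negatives --problem ResolutionOfSingularities`: nothing on it;
* `not_inductiveStep_iff_exists_minimal` — … equivalently a prime `p` and a LEAST dimension `d` at which
  `SchonAt p d` fails while all lower dimensions hold; since `d ≤ 1` holds on paper (points; Riemann–Roch
  units + Bertini for curves — the support item `SchonLowDim`), a counterexample is a very affine variety
  of dimension `≥ 2` over an algebraically closed field of characteristic `p` none of whose principal opens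
  `U[G⁻¹]`, re-embedded by `(x, G)`, has all initial degenerations regular;
* `inductiveStep_iff_isSchonIdeal_form` — the crux with its inlined schön clause
  `∀ w P, IsRegularLocalRing (Localization.AtPrime P)` replaced by the tree's named notion
  `Literature.AlgebraicGeometry.Tropical.IsSchonIdeal ⟨ι I, y_j − ι G_j⟩` (definition file
  `Tropical/SchonIdeal`), via the bridge `inductiveStep_weightInitialIdeal_eq_span`.

ELABORATION NOTE.  The route file elaborates under `open scoped Classical`; the `DecidablePred` instance
inside `f.coeff.filter (fun v => …)` of the inlined initial form is then the classical one, so the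
definition file's `weightInitialIdeal_eq_span` (proved by `rfl` in a non-classical context) does NOT fire
against the route's term — the bridge below takes the instance as an explicit argument `dec` and is proved by `congr!`
(subsingleton elimination on the instance); files citing these decls should `open scoped Classical`.

Companion file `InductiveStepWithoutIsPrimeIff.lean` (junk guards / primality inert); full analysis in the
crux workfile `Cruxes/InductiveStep/Disproof.lean`.
-/

set_option linter.dupNamespace false -- mandated namespace of this single-conjunct summit

open Summit.ResolutionOfSingularities.ResolutionOfSingularities.Theses.TropicalLinks
open scoped Classical

namespace Summit.ResolutionOfSingularities.ResolutionOfSingularities.Theorems.InductiveStep.Negative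

/-- **A refutation of the crux is exactly a refutation of the target.** `InductiveStep ↔ SchonPlus`
(strong induction / weakening), contraposed. [folklore] -/
theorem not_inductiveStep_iff_not_schonPlus : ¬ InductiveStep ↔ ¬ SchonPlus := by
  refine not_congr ⟨fun h p hp d => ?_, fun h p hp d _ => h p hp d⟩
  induction d using Nat.strong_induction_on with
  | _ d ih => exact h p hp d ih

/-- **The exact shape of a counterexample to `InductiveStep`: a prime `p` and a MINIMAL failing
dimension** — `SchonAt p d` false with `SchonAt p d'` true for all `d' < d` (displayed: `SchonAt` is the
inlined λ of the route). [folklore] -/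
theorem not_inductiveStep_iff_exists_minimal :
    ¬ InductiveStep ↔ ∃ p : ℕ, p.Prime ∧ ∃ d : ℕ, (∀ d' < d, (fun (p d : ℕ) => ∀ (k : Type) [Field k] [CharP k p] [IsAlgClosed k] (N : ℕ) (I : Ideal (AddMonoidAlgebra k (Fin N → ℤ))), I.IsPrime → ringKrullDim (AddMonoidAlgebra k (Fin N → ℤ) ⧸ I) = (d : WithBot ℕ∞) → ∃ (m : ℕ) (G : Fin m → AddMonoidAlgebra k (Fin N → ℤ)), (∀ j, G j ∉ I) ∧ ∀ (w : Fin (N + m) → ℤ) (P : Ideal (AddMonoidAlgebra k (Fin (N + m) → ℤ) ⧸ Ideal.span ((fun f : AddMonoidAlgebra k (Fin (N + m) → ℤ) => AddMonoidAlgebra.ofCoeff (f.coeff.filter fun v => ∀ u ∈ f.coeff.support, ∑ i, w i * v i ≤ ∑ i, w i * u i)) '' (↑(Ideal.span ((fun f : AddMonoidAlgebra k (Fin N → ℤ) => (AddMonoidAlgebra.ofCoeff (f.coeff.mapDomain fun v => Fin.append v (0 : Fin m → ℤ)) : AddMonoidAlgebra k (Fin (N + m) → ℤ))) '' (↑I :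 Set (AddMonoidAlgebra k (Fin N → ℤ))) ∪ Set.range (fun j : Fin m => AddMonoidAlgebra.single (Fin.append (0 : Fin N → ℤ) (Pi.single j (1 : ℤ))) (1 : k) - AddMonoidAlgebra.ofCoeff ((G j).coeff.mapDomain fun v => Fin.append v (0 : Fin m → ℤ))))) : Set (AddMonoidAlgebra k (Fin (N + m) → ℤ)))))) [P.IsPrime], IsRegularLocalRing (Localization.AtPrime P)) p d') ∧ ¬ (fun (p d : ℕ) => ∀ (k : Type) [Field k] [CharP k p] [IsAlgClosed k] (N : ℕ) (I : Ideal (AddMonoidAlgebra k (Fin N → ℤ))), I.IsPrime → ringKrullDim (AddMonoidAlgebra k (Fin N → ℤ) ⧸ I) = (d : WithBot ℕ∞) → ∃ (m : ℕ) (G : Fin m → AddMonoidAlgebra k (Fin N → ℤ)), (∀ j, G j ∉ I) ∧ ∀ (w : Fin (N + m) → ℤ) (P : Ideal (AddMonoidAlgebra k (Fin (N + m) → ℤ) ⧸ Ideal.span ((fun f : AddMonoidAlgebra k (Fin (N + m) → ℤ) => AddMonoidAlgebra.ofCoeff (f.coeff.filter fun v => ∀ u ∈ f.coeff.support, ∑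 i, w i * v i ≤ ∑ i, w i * u i)) '' (↑(Ideal.span ((fun f : AddMonoidAlgebra k (Fin N → ℤ) => (AddMonoidAlgebra.ofCoeff (f.coeff.mapDomain fun v => Fin.append v (0 : Fin m → ℤ)) : AddMonoidAlgebra k (Fin (N + m) → ℤ))) '' (↑I : Set (AddMonoidAlgebra k (Fin N → ℤ))) ∪ Set.range (fun j : Fin m => AddMonoidAlgebra.single (Fin.append (0 : Fin N → ℤ) (Pi.single j (1 : ℤ))) (1 : k) - AddMonoidAlgebra.ofCoeff ((G j).coeff.mapDomain fun v => Fin.append v (0 : Fin m → ℤ))))) : Set (AddMonoidAlgebra k (Fin (N + m) → ℤ)))))) [P.IsPrime], IsRegularLocalRing (Localization.AtPrime P)) p d := by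
  unfold InductiveStep
  push Not
  rfl

/-- … and, forgetting minimality, a prime `p` and a dimension `d` with `¬ SchonAt p d`; by well-ordering
of `ℕ` the two shapes are equivalent. [folklore] -/
theorem not_inductiveStep_iff_exists :
    ¬ InductiveStep ↔ ∃ p : ℕ, p.Prime ∧ ∃ d : ℕ, ¬ (fun (p d : ℕ) => ∀ (k : Type) [Field k] [CharP k p] [IsAlgClosed k] (N : ℕ) (I : Ideal (AddMonoidAlgebra k (Fin N → ℤ))), I.IsPrime → ringKrullDim (AddMonoidAlgebra k (Fin N → ℤ) ⧸ I) = (d : WithBot ℕ∞) → ∃ (m : ℕ) (G : Fin m → AddMonoidAlgebra k (Fin N → ℤ)), (∀ j, G j ∉ I) ∧ ∀ (w : Fin (N + m) → ℤ) (P : Ideal (AddMonoidAlgebra k (Fin (N + m) → ℤ) ⧸ Ideal.span ((fun f : AddMonoidAlgebra k (Fin (N + m) → ℤ) => AddMonoidAlgebra.ofCoeff (f.coeff.filter fun v => ∀ u ∈ f.coeff.support, ∑ i, w i * v i ≤ ∑ i, w i * u i)) '' (↑(Ideal.span ((fun f : AddMonoidAlgebra k (Fin N → ℤ) => (AddMonoidAlgebra.ofCoeff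 (f.coeff.mapDomain fun v => Fin.append v (0 : Fin m → ℤ)) : AddMonoidAlgebra k (Fin (N + m) → ℤ))) '' (↑I : Set (AddMonoidAlgebra k (Fin N → ℤ))) ∪ Set.range (fun j : Fin m => AddMonoidAlgebra.single (Fin.append (0 : Fin N → ℤ) (Pi.single j (1 : ℤ))) (1 : k) - AddMonoidAlgebra.ofCoeff ((G j).coeff.mapDomain fun v => Fin.append v (0 : Fin m → ℤ))))) : Set (AddMonoidAlgebra k (Fin (N + m) → ℤ)))))) [P.IsPrime], IsRegularLocalRing (Localization.AtPrime P)) p d := by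
  rw [not_inductiveStep_iff_not_schonPlus]
  unfold SchonPlus
  push Not
  rfl

/-! ### The crux through the tree's named notion `IsSchonIdeal` -/

/-- **Bridge to the definition file**: the tree's `weightInitialIdeal w J` IS the route's inlined
initial ideal `Ideal.span (in_w '' J)` — for ANY decidability instance `dec` hidden in `Finsupp.filter`
(the route's term carries the classical one, the definition file's the constructive one; they are
propositionally, not definitionally, equal — closed by subsingleton elimination). [folklore] -/
theorem inductiveStep_weightInitialIdeal_eq_span {k : Type} [Field k] {M : ℕ} (w : Fin M → ℤ)
    (J : Ideal (AddMonoidAlgebra k (Fin M → ℤ)))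
    (dec : ∀ f : AddMonoidAlgebra k (Fin M → ℤ),
      DecidablePred fun v : Fin M → ℤ => ∀ u ∈ f.coeff.support, ∑ i, w i * v i ≤ ∑ i, w i * u i) :
    Literature.AlgebraicGeometry.Tropical.weightInitialIdeal w J =
      Ideal.span ((fun f : AddMonoidAlgebra k (Fin M → ℤ) => AddMonoidAlgebra.ofCoeff (@Finsupp.filter (Fin M → ℤ) k _ (fun v => ∀ u ∈ f.coeff.support, ∑ i, w i * v i ≤ ∑ i, w i * u i) (dec f) f.coeff)) '' (↑J : Set (AddMonoidAlgebra k (Fin M → ℤ)))) := by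
  unfold Literature.AlgebraicGeometry.Tropical.weightInitialIdeal
    Literature.AlgebraicGeometry.Tropical.initialIdeal Literature.AlgebraicGeometry.Tropical.initialForm
    Literature.AlgebraicGeometry.Tropical.dotWeight
  congr! 5

/-- Transport of the clause "all localizations of `R ⧸ J` at primes are regular" along an equality of
ideals. [folklore] -/
theorem inductiveStep_forall_prime_congr {k : Type} [Field k] {M : ℕ}
    {J₁ J₂ : Ideal (AddMonoidAlgebra k (Fin M → ℤ))} (h : J₁ = J₂) :
    (∀ (P : Ideal (AddMonoidAlgebra k (Fin M → ℤ) ⧸ J₁)) [P.IsPrime],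
        IsRegularLocalRing (Localization.AtPrime P)) ↔
      (∀ (P : Ideal (AddMonoidAlgebra k (Fin M → ℤ) ⧸ J₂)) [P.IsPrime],
        IsRegularLocalRing (Localization.AtPrime P)) := by
  subst h
  exact Iff.rfl

/-- **The route's schön clause is `IsSchonIdeal`**: for any ideal `J ⊆ k[ℤ^M]` (and any decidability
instances `dec`), `(∀ w P, IsRegularLocalRing (Localization.AtPrime P))` over the inlined degenerations
`k[ℤ^M] ⧸ in_w(J)` is `Literature.AlgebraicGeometry.Tropical.IsSchonIdeal J`. [folklore] -/
theorem inductiveStep_schonClause_iff_isSchonIdeal {k : Type} [Field k] {M : ℕ}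
    (J : Ideal (AddMonoidAlgebra k (Fin M → ℤ)))
    (dec : ∀ (w : Fin M → ℤ) (f : AddMonoidAlgebra k (Fin M → ℤ)),
      DecidablePred fun v : Fin M → ℤ => ∀ u ∈ f.coeff.support, ∑ i, w i * v i ≤ ∑ i, w i * u i) :
    (∀ (w : Fin M → ℤ) (P : Ideal (AddMonoidAlgebra k (Fin M → ℤ) ⧸
        Ideal.span ((fun f : AddMonoidAlgebra k (Fin M → ℤ) => AddMonoidAlgebra.ofCoeff (@Finsupp.filter (Fin M → ℤ) k _ (fun v => ∀ u ∈ f.coeff.support, ∑ i, w i * v i ≤ ∑ i, w i * u i) (dec w f) f.coeff)) '' (↑J : Set (AddMonoidAlgebra k (Fin M → ℤ)))))) [P.IsPrime],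
        IsRegularLocalRing (Localization.AtPrime P)) ↔
      Literature.AlgebraicGeometry.Tropical.IsSchonIdeal J :=
  forall_congr' fun w =>
    inductiveStep_forall_prime_congr (inductiveStep_weightInitialIdeal_eq_span w J (dec w)).symm

/-- `SchonAt p d` in `IsSchonIdeal` form implies the inlined `SchonAt p d`. [folklore] -/
theorem inductiveStep_schonAt_of_isSchonIdealForm (p d : ℕ)
    (h : ∀ (k : Type) [Field k] [CharP k p] [IsAlgClosed k] (N : ℕ) (I : Ideal (AddMonoidAlgebra k (Fin N → ℤ))), I.IsPrime → ringKrullDim (AddMonoidAlgebra k (Fin N → ℤ) ⧸ I) = (d : WithBot ℕ∞) → ∃ (m : ℕ) (G : Fin m → AddMonoidAlgebra k (Fin N → ℤ)), (∀ j, G j ∉ I) ∧ Literature.AlgebraicGeometry.Tropical.IsSchonIdeal (Ideal.span ((fun f : AddMonoidAlgebra k (Fin N → ℤ) => (AddMonoidAlgebra.ofCoeff (f.coeff.mapDomain fun v => Fin.append v (0 : Fin m → ℤ)) : AddMonoidAlgebra k (Fin (N + m) → ℤ))) '' (↑I : Set (AddMonoidAlgebra k (Fin N → ℤ))) ∪ Set.range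 (fun j : Fin m => AddMonoidAlgebra.single (Fin.append (0 : Fin N → ℤ) (Pi.single j (1 : ℤ))) (1 : k) - AddMonoidAlgebra.ofCoeff ((G j).coeff.mapDomain fun v => Fin.append v (0 : Fin m → ℤ)))))) :
    ∀ (k : Type) [Field k] [CharP k p] [IsAlgClosed k] (N : ℕ) (I : Ideal (AddMonoidAlgebra k (Fin N → ℤ))), I.IsPrime → ringKrullDim (AddMonoidAlgebra k (Fin N → ℤ) ⧸ I) = (d : WithBot ℕ∞) → ∃ (m : ℕ) (G : Fin m → AddMonoidAlgebra k (Fin N → ℤ)), (∀ j, G j ∉ I) ∧ ∀ (w : Fin (N + m) → ℤ) (P : Ideal (AddMonoidAlgebra k (Fin (N + m) → ℤ) ⧸ Ideal.span ((fun f : AddMonoidAlgebra k (Fin (N + m) → ℤ) => AddMonoidAlgebra.ofCoeff (f.coeff.filter fun v => ∀ u ∈ f.coeff.support, ∑ i, w i * v i ≤ ∑ i, w i * u i)) '' (↑(Ideal.span ((fun f : AddMonoidAlgebra k (Fin N → ℤ) => (AddMonoidAlgebra.ofCoeff (f.coeff.mapDomain fun v => Fin.append v (0 : Fin m → ℤ))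 : AddMonoidAlgebra k (Fin (N + m) → ℤ))) '' (↑I : Set (AddMonoidAlgebra k (Fin N → ℤ))) ∪ Set.range (fun j : Fin m => AddMonoidAlgebra.single (Fin.append (0 : Fin N → ℤ) (Pi.single j (1 : ℤ))) (1 : k) - AddMonoidAlgebra.ofCoeff ((G j).coeff.mapDomain fun v => Fin.append v (0 : Fin m → ℤ))))) : Set (AddMonoidAlgebra k (Fin (N + m) → ℤ)))))) [P.IsPrime], IsRegularLocalRing (Localization.AtPrime P) := by
  intro k _ _ _ N I hI hdim
  obtain ⟨m, G, hG, hS⟩ := h k N I hI hdim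
  exact ⟨m, G, hG, (inductiveStep_schonClause_iff_isSchonIdeal _ _).2 hS⟩

/-- The inlined `SchonAt p d` implies its `IsSchonIdeal` form. [folklore] -/
theorem inductiveStep_isSchonIdealForm_of_schonAt (p d : ℕ)
    (h : ∀ (k : Type) [Field k] [CharP k p] [IsAlgClosed k] (N : ℕ) (I : Ideal (AddMonoidAlgebra k (Fin N → ℤ))), I.IsPrime → ringKrullDim (AddMonoidAlgebra k (Fin N → ℤ) ⧸ I) = (d : WithBot ℕ∞) → ∃ (m : ℕ) (G : Fin m → AddMonoidAlgebra k (Fin N → ℤ)), (∀ j, G j ∉ I) ∧ ∀ (w : Fin (N + m) → ℤ) (P : Ideal (AddMonoidAlgebra k (Fin (N + m) → ℤ) ⧸ Ideal.span ((fun f : AddMonoidAlgebra k (Fin (N + m) → ℤ) => AddMonoidAlgebra.ofCoeff (f.coeff.filter fun v => ∀ u ∈ f.coeff.support, ∑ i, w i * v i ≤ ∑ i, w i * u i)) '' (↑(Ideal.span ((fun f : AddMonoidAlgebra k (Fin N → ℤ) => (AddMonoidAlgebra.ofCoeff (f.coeff.mapDomain fun v => Fin.append v (0 : Fin m → ℤ))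 : AddMonoidAlgebra k (Fin (N + m) → ℤ))) '' (↑I : Set (AddMonoidAlgebra k (Fin N → ℤ))) ∪ Set.range (fun j : Fin m => AddMonoidAlgebra.single (Fin.append (0 : Fin N → ℤ) (Pi.single j (1 : ℤ))) (1 : k) - AddMonoidAlgebra.ofCoeff ((G j).coeff.mapDomain fun v => Fin.append v (0 : Fin m → ℤ))))) : Set (AddMonoidAlgebra k (Fin (N + m) → ℤ)))))) [P.IsPrime], IsRegularLocalRing (Localization.AtPrime P)) :
    ∀ (k : Type) [Field k] [CharP k p] [IsAlgClosed k] (N : ℕ) (I : Ideal (AddMonoidAlgebra k (Fin N → ℤ))), I.IsPrime → ringKrullDim (AddMonoidAlgebra k (Fin N → ℤ) ⧸ I) = (d : WithBot ℕ∞) → ∃ (m : ℕ) (G : Fin m → AddMonoidAlgebra k (Fin N → ℤ)), (∀ j, G j ∉ I) ∧ Literature.AlgebraicGeometry.Tropical.IsSchonIdeal (Ideal.span ((fun f : AddMonoidAlgebra k (Fin N → ℤ) => (AddMonoidAlgebra.ofCoeff (f.coeff.mapDomain fun v => Fin.append v (0 : Fin m → ℤ)) : AddMonoidAlgebra k (Fin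 (N + m) → ℤ))) '' (↑I : Set (AddMonoidAlgebra k (Fin N → ℤ))) ∪ Set.range (fun j : Fin m => AddMonoidAlgebra.single (Fin.append (0 : Fin N → ℤ) (Pi.single j (1 : ℤ))) (1 : k) - AddMonoidAlgebra.ofCoeff ((G j).coeff.mapDomain fun v => Fin.append v (0 : Fin m → ℤ))))) := by
  intro k _ _ _ N I hI hdim
  obtain ⟨m, G, hG, hS⟩ := h k N I hI hdim
  exact ⟨m, G, hG, (inductiveStep_schonClause_iff_isSchonIdeal _ _).1 hS⟩

/-- **The crux restated through `IsSchonIdeal`** (same meaning, the schön clause named): `InductiveStep`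
is equivalent to `∀ p prime, ∀ d, (∀ d' < d, T p d') → T p d` with
`T p d := ∀ k N I, I prime, dim = d → ∃ m G, (∀ j, G j ∉ I) ∧ IsSchonIdeal ⟨ι I, y_j − ι G_j⟩`.
[folklore] -/
theorem inductiveStep_iff_isSchonIdeal_form :
    InductiveStep ↔ (∀ p : ℕ, p.Prime → ∀ d : ℕ, (∀ d' < d, (fun (p d : ℕ) => ∀ (k : Type) [Field k] [CharP k p] [IsAlgClosed k] (N : ℕ) (I : Ideal (AddMonoidAlgebra k (Fin N → ℤ))), I.IsPrime → ringKrullDim (AddMonoidAlgebra k (Fin N → ℤ) ⧸ I) = (d : WithBot ℕ∞) → ∃ (m : ℕ) (G : Fin m → AddMonoidAlgebra k (Fin N → ℤ)), (∀ j, G j ∉ I) ∧ Literature.AlgebraicGeometry.Tropical.IsSchonIdeal (Ideal.span ((fun f : AddMonoidAlgebra k (Fin N → ℤ) => (AddMonoidAlgebra.ofCoeff (f.coeff.mapDomain fun v => Fin.append v (0 : Fin m → ℤ)) : AddMonoidAlgebra k (Fin (N + m) → ℤ))) '' (↑I : Set (AddMonoidAlgebra k (Fin N → ℤ))) ∪ Set.range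 (fun j : Fin m => AddMonoidAlgebra.single (Fin.append (0 : Fin N → ℤ) (Pi.single j (1 : ℤ))) (1 : k) - AddMonoidAlgebra.ofCoeff ((G j).coeff.mapDomain fun v => Fin.append v (0 : Fin m → ℤ)))))) p d') → (fun (p d : ℕ) => ∀ (k : Type) [Field k] [CharP k p] [IsAlgClosed k] (N : ℕ) (I : Ideal (AddMonoidAlgebra k (Fin N → ℤ))), I.IsPrime → ringKrullDim (AddMonoidAlgebra k (Fin N → ℤ) ⧸ I) = (d : WithBot ℕ∞) → ∃ (m : ℕ) (G : Fin m → AddMonoidAlgebra k (Fin N → ℤ)), (∀ j, G j ∉ I) ∧ Literature.AlgebraicGeometry.Tropical.IsSchonIdeal (Ideal.span ((fun f : AddMonoidAlgebra k (Fin N → ℤ) => (AddMonoidAlgebra.ofCoeff (f.coeff.mapDomain fun v => Fin.append v (0 : Fin m → ℤ)) : AddMonoidAlgebra k (Fin (N + m) → ℤ))) '' (↑I : Set (AddMonoidAlgebra k (Fin N → ℤ))) ∪ Set.range (fun j : Fin m => AddMonoidAlgebra.single (Fin.append (0 : Fin N → ℤ) (Pi.single j (1 : ℤ))) (1 : k)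 - AddMonoidAlgebra.ofCoeff ((G j).coeff.mapDomain fun v => Fin.append v (0 : Fin m → ℤ)))))) p d) := by
  constructor
  · intro h p hp d ih
    exact inductiveStep_isSchonIdealForm_of_schonAt p d
      (h p hp d fun d' hd' => inductiveStep_schonAt_of_isSchonIdealForm p d' (ih d' hd'))
  · intro h p hp d ih
    exact inductiveStep_schonAt_of_isSchonIdealForm p d
      (h p hp d fun d' hd' => inductiveStep_isSchonIdealForm_of_schonAt p d' (ih d' hd'))

end Summit.ResolutionOfSingularities.ResolutionOfSingularities.Theorems.InductiveStep.Negative
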